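import Summits.MatrixMultiplication.MatrixMultiplication.Theorems.EdgePencilDefectCone
import HarnessLib

/-!
# The defect pencils at the route's declarations: the priced two-leaf cuts of `TetrahedronCarving`

Support kernel for `stmt-MatrixMultiplication-26697` (`TetraExcessZero`) of route `TetrahedronCarving`
(lineage `decomp-mm-lens-6`, generation 21), companion of `EdgePencilDefectCone` (the pencils
`A_k : ω(K₄) − 4 ≤ k·(ω(2,1,2) − 4)`, `B_c : 4 + c·(ω − 2) ≤ ω(K₄)` and the
pricing theorem `A_k ∧ B_c ⟹ ω = 2` for `c > k·κ(α)`), specialised to `ℂ` and the route's declarations: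

* `A_0 = TetraFlat`, `A_1 = TetraExcessZero`, `B_2 = TetraNoSaving` (as `Iff`s); NEC of every member;
  `TetraNoSaving ⟹ TetraPlusTwo : ω + 2 ≤ ω(K₄)` and `TetraExcessZero ⟹ A_2 : ω(K₄) + 4 ≤ 2ω(2,1,2)`.
* the cut of record `(k,c) = (1,2)` as an instance; the two **one-notch re-cuts** priced by `0 < α`
  (Coppersmith 1982, tree decl `coppersmith1982_dualExponentAlpha_gt`, here a hypothesis):
  `TetraExcessZero → TetraPlusTwo → 0 < α → ω = 2` and `A_2 → TetraNoSaving → 0 < α → ω = 2`, with the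
  matching `Iff`s; the record-priced families `ω = 2 ⟺ A_k ∧ TetraNoSaving` (`0 ≤ k ≤ 3.79`) and
  `ω = 2 ⟺ TetraExcessZero ∧ B_c` (`c ≥ 0.5267`) given `α ≥ 0.3213`.
* the cores at the route's declarations: `A_k → HalfAlpha → TetraFlat`, `B_c → TetraFlat → ω = 2` (`c > 0`).

References: Christandl–Vrana–Zuiddam, arXiv:1609.07476, §1.2–1.3 (graph tensors, `ω(K₄)`, Question 1.3.2);
Lotti–Romani 1983 (`ω(1,k,1)` convex, flat on `[0,α]`); Coppersmith 1982 (`α > 0.17227`);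
Vassilevska Williams–Xu–Xu–Zhou 2024 (`α > 0.321334`); Brand et al. 2026, Thm. 48 (`ω(K₄) < 4.633908`).
[ChristandlVranaZuiddam2016] [LottiRomani1983] [Coppersmith1982] [VassilevskaWilliamsXuXuZhou2024] [BrandEtAl2026]
-/

noncomputable section

set_option linter.dupNamespace false

open Literature.Computability.AlgebraicComplexity
open Summit.MatrixMultiplication.MatrixMultiplication.Theorems.TetrahedronTensor
open Summit.MatrixMultiplication.MatrixMultiplication.Theses.TetrahedronCarving

namespace Summit.MatrixMultiplication.MatrixMultiplication.Theorems.EdgePencil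

section Route

/-- `A_0 ⟺ TetraFlat`. -/
theorem defectRatioLE_zero_iff_tetraFlat :
    omegaTetra ℂ - 4 ≤ 0 * (omegaRect ℂ 2 1 2 - 4) ↔ TetraFlat :=
  defectRatioLE_zero_iff ℂ

/-- `A_1 ⟺ TetraExcessZero` (the attacked leaf of record). -/
theorem defectRatioLE_one_iff_tetraExcessZero :
    omegaTetra ℂ - 4 ≤ 1 * (omegaRect ℂ 2 1 2 - 4) ↔ TetraExcessZero :=
  defectRatioLE_one_iff ℂ

/-- `B_2 ⟺ TetraNoSaving` (the residual of record). -/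
theorem transferGE_two_iff_tetraNoSaving :
    4 + 2 * (omega ℂ - 2) ≤ omegaTetra ℂ ↔ TetraNoSaving :=
  transferGE_two_iff ℂ

/-- NEC: `ω = 2 ⟹ A_k` for every `k`. -/
theorem defectRatioLE_of_matrixMultiplication (k : ℝ) (hS : _root_.MatrixMultiplication) :
    omegaTetra ℂ - 4 ≤ k * (omegaRect ℂ 2 1 2 - 4) :=
  defectRatioLE_of_omega_eq_two ℂ k (_root_.MatrixMultiplication_iff.1 hS)

/-- NEC: `ω = 2 ⟹ B_c` for every `c`. -/
theorem transferGE_of_matrixMultiplication (c : ℝ) (hS : _root_.MatrixMultiplication) :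
    4 + c * (omega ℂ - 2) ≤ omegaTetra ℂ :=
  transferGE_of_omega_eq_two ℂ c (_root_.MatrixMultiplication_iff.1 hS)

/-- NEC: `ω = 2 ⟹ TetraPlusTwo`. -/
theorem plusTwo_of_matrixMultiplication (hS : _root_.MatrixMultiplication) :
    omega ℂ + 2 ≤ omegaTetra ℂ :=
  (transferGE_one_iff ℂ).1 (transferGE_of_matrixMultiplication 1 hS)

/-- NEC: `ω = 2 ⟹ A_2`. -/
theorem doubleDefect_of_matrixMultiplication (hS : _root_.MatrixMultiplication) :
    omegaTetra ℂ + 4 ≤ 2 * omegaRect ℂ 2 1 2 :=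
  (defectRatioLE_two_iff ℂ).1 (defectRatioLE_of_matrixMultiplication 2 hS)

/-- `TetraNoSaving ⟹ TetraPlusTwo` (strictly weaker relative to the record: `DefectWeb.plusTwo_undecided`). -/
theorem plusTwo_of_tetraNoSaving (hB : TetraNoSaving) : omega ℂ + 2 ≤ omegaTetra ℂ := by
  have := omega_two_le ℂ
  have hB' : 2 * omega ℂ ≤ omegaTetra ℂ := hB
  linarith

/-- `TetraExcessZero ⟹ A_2` (strictly weaker relative to the record: `DefectWeb.doubleDefect_undecided`). -/
theorem doubleDefect_of_tetraExcessZero (hA : TetraExcessZero) :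
    omegaTetra ℂ + 4 ≤ 2 * omegaRect ℂ 2 1 2 := by
  have := four_le_omegaRect_two_one_two ℂ
  have hA' : omegaTetra ℂ ≤ omegaRect ℂ 2 1 2 := hA
  linarith

/-- **THE GENERAL TWO-LEAF CUT**: `A_k → B_c → ω = 2` for every `0 ≤ k`, `0 ≤ a ≤ min(α,1/2)`, `c > k·κ(a)`. -/
theorem matrixMultiplication_of_defectRatioLE_of_transferGE {k c a : ℝ} (ha0 : 0 ≤ a) (ha : a ≤ 1 / 2)
    (hα : a ≤ dualExponentAlpha ℂ) (hk : 0 ≤ k) (hkc : k * ((1 - 2 * a) / (1 - a)) < c)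
    (hA : omegaTetra ℂ - 4 ≤ k * (omegaRect ℂ 2 1 2 - 4)) (hB : 4 + c * (omega ℂ - 2) ≤ omegaTetra ℂ) :
    _root_.MatrixMultiplication :=
  _root_.MatrixMultiplication_iff.2
    (omega_eq_two_of_defectRatioLE_of_transferGE ℂ ha0 ha hα hk hkc hA hB)

/-- The cut of record is the instance `(k,c) = (1,2)`: `TetraExcessZero → TetraNoSaving → ω = 2`. -/
example (hA : TetraExcessZero) (hB : TetraNoSaving) : _root_.MatrixMultiplication :=
  _root_.MatrixMultiplication_iff.2 (omega_eq_two_of_defectRatioLE_of_transferGE_of_lt ℂ zero_le_one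
    one_lt_two (defectRatioLE_one_iff_tetraExcessZero.2 hA) (transferGE_two_iff_tetraNoSaving.2 hB))

/-- **Candidate re-cut (1,1)**: `TetraExcessZero → TetraPlusTwo → (0 < α) → ω = 2` — the residual of record
weakened one notch at the price of the support item `0 < α` (Coppersmith 1982, a named tree theorem).
[cite: Coppersmith1982, Thm. 1] -/
theorem matrixMultiplication_of_excessZero_of_plusTwo (hA : TetraExcessZero)
    (hB : omega ℂ + 2 ≤ omegaTetra ℂ) (hα : 0 < dualExponentAlpha ℂ) : _root_.MatrixMultiplication :=
  _root_.MatrixMultiplication_iff.2 (omega_eq_two_of_excessZero_of_plusTwo ℂ hα hA hB)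

/-- `S ⟺ TetraExcessZero ∧ TetraPlusTwo`, given `0 < α`. -/
theorem matrixMultiplication_iff_excessZero_and_plusTwo (hα : 0 < dualExponentAlpha ℂ) :
    _root_.MatrixMultiplication ↔ TetraExcessZero ∧ omega ℂ + 2 ≤ omegaTetra ℂ :=
  ⟨fun hS => ⟨excessZero_of_matrixMultiplication hS, plusTwo_of_matrixMultiplication hS⟩,
    fun h => matrixMultiplication_of_excessZero_of_plusTwo h.1 h.2 hα⟩

/-- **Candidate re-cut (2,2)**: `A_2 → TetraNoSaving → (0 < α) → ω = 2` — the attacked leaf weakened one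
notch, residual of record unchanged. [cite: Coppersmith1982, Thm. 1] -/
theorem matrixMultiplication_of_doubleDefect_of_tetraNoSaving
    (hA : omegaTetra ℂ + 4 ≤ 2 * omegaRect ℂ 2 1 2) (hB : TetraNoSaving) (hα : 0 < dualExponentAlpha ℂ) :
    _root_.MatrixMultiplication :=
  _root_.MatrixMultiplication_iff.2 (omega_eq_two_of_doubleDefect_of_noSaving ℂ hα hA hB)

/-- `S ⟺ A_2 ∧ TetraNoSaving`, given `0 < α`. -/
theorem matrixMultiplication_iff_doubleDefect_and_tetraNoSaving (hα : 0 < dualExponentAlpha ℂ) :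
    _root_.MatrixMultiplication ↔ omegaTetra ℂ + 4 ≤ 2 * omegaRect ℂ 2 1 2 ∧ TetraNoSaving :=
  ⟨fun hS => ⟨doubleDefect_of_matrixMultiplication hS, (matrixMultiplication_iff_tetra.1 hS).2⟩,
    fun h => matrixMultiplication_of_doubleDefect_of_tetraNoSaving h.1 h.2 hα⟩

/-- `S ⟺ A_k ∧ TetraNoSaving` for every `0 ≤ k ≤ 3.79`, given the printed `α ≥ 0.3213`. -/
theorem matrixMultiplication_iff_defectRatioLE_and_tetraNoSaving (hα : (0.3213 : ℝ) ≤ dualExponentAlpha ℂ)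
    {k : ℝ} (hk : 0 ≤ k) (hk' : k ≤ 3.79) :
    _root_.MatrixMultiplication ↔ omegaTetra ℂ - 4 ≤ k * (omegaRect ℂ 2 1 2 - 4) ∧ TetraNoSaving :=
  ⟨fun hS => ⟨defectRatioLE_of_matrixMultiplication k hS, (matrixMultiplication_iff_tetra.1 hS).2⟩,
    fun h => _root_.MatrixMultiplication_iff.2
      (omega_eq_two_of_defectRatioLE_of_noSaving_record ℂ hα hk hk' h.1 h.2)⟩

/-- `S ⟺ TetraExcessZero ∧ B_c` for every `c ≥ 0.5267`, given the printed `α ≥ 0.3213`. -/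
theorem matrixMultiplication_iff_tetraExcessZero_and_transferGE (hα : (0.3213 : ℝ) ≤ dualExponentAlpha ℂ)
    {c : ℝ} (hc : 0.5267 ≤ c) :
    _root_.MatrixMultiplication ↔ TetraExcessZero ∧ 4 + c * (omega ℂ - 2) ≤ omegaTetra ℂ :=
  ⟨fun hS => ⟨excessZero_of_matrixMultiplication hS, transferGE_of_matrixMultiplication c hS⟩,
    fun h => _root_.MatrixMultiplication_iff.2
      (omega_eq_two_of_excessZero_of_transferGE_record ℂ hα hc h.1 h.2)⟩

/-- The `A`-core at the route's declarations: `A_k → HalfAlpha → TetraFlat` (every `k`). -/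
theorem tetraFlat_of_defectRatioLE_of_halfAlpha {k : ℝ}
    (hA : omegaTetra ℂ - 4 ≤ k * (omegaRect ℂ 2 1 2 - 4)) (hα : HalfAlpha) :
    TetraFlat :=
  omegaTetra_le_four_of_defectRatioLE ℂ hA
    ((omegaRect_two_one_two_le_four_iff_half_le_dualExponentAlpha ℂ).2 hα)

/-- The `B`-core at the route's declarations: `B_c → TetraFlat → ω = 2` (every `c > 0`). -/
theorem matrixMultiplication_of_transferGE_of_tetraFlat {c : ℝ} (hc : 0 < c)
    (hB : 4 + c * (omega ℂ - 2) ≤ omegaTetra ℂ)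
    (ht : TetraFlat) : _root_.MatrixMultiplication :=
  _root_.MatrixMultiplication_iff.2 (omega_eq_two_of_transferGE_of_omegaTetra_le_four ℂ hc hB ht)

end Route

end Summit.MatrixMultiplication.MatrixMultiplication.Theorems.EdgePencil

end
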